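import Summits.Ventures.Crystal3D.Theorems.StickyWulffConstantTextureLiminfTexShadowLevelReachBornBarlowTop
import Summits.Ventures.Crystal3D.Theorems.StickyWulffConstantTextureLiminfTexShadowLevelReachHexagonBarlowShapeTop
import Summits.Ventures.Crystal3D.Theorems.StickyWulffConstantCoaxialWallLawEndRowRootDischarge
import Summits.Ventures.Crystal3D.Theorems.StickyWulffConstantCoaxialWallLawEndRowJointDefs
import HarnessLib

/-!
# Both plates AND FINITELY MANY born families under ONE bi-frame row (the (β) global-pooling census with all presentable born classes)
# (lane T, crux `TextureLiminfV5`, stmt-Ventures-23912, registered stub `stub_terraceCensus`; (β) assembly RESUME (d) — cf-p1 (cccxii); PRESENTABLE-SUPPLY-g24 §2: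
# TWO presentable rising directions at interface 1 and TWO falling at interface n carry the margin)

HONEST FRAMING. Venture `Summits/Ventures/Crystal3D` (cell `crystal3d-full`), route `route-Ventures-StickyWulffConstant`, helper `--supports` the law-v5
crux `TextureLiminfV5` (stmt-Ventures-23912), lane T, mechanism (β).  Census-free, certificate-free: the row `LocalEndRowA ver sF (basalSystem Fr) (basalSystem G₂)`
BY NAME; `KissingGap δ` / `KissingClassification δ` by name; nothing about energies; F-C1 not moved.

THE POINT.  `fourFamily_sources_le_payers_cuts` (…LevelReachFourFamilyPooled) with the single rising / falling born family replaced by FINITE FAMILIES of them: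
rising born families `(A i, w i, B i)`, `i : ι₁`, with pairwise distinct directions `A i (w i)` (`hinj₁`), none a basal direction of `Fr` (`hdir₁`), each presented
in the two plate systems' word nets (`hadm₁`); falling families `j : ι₂` likewise w.r.t. `G₂`.  All families are pairwise disjoint as end-pair sets (rising vs
falling by the sign of `(bq.1 − bq.2)₂`, same side by direction), every pair is an `IsEndPairA` of `(basalSystem Fr, basalSystem G₂)`, and ONE application of
`card_endPairs_le_of_localRowA` gives **`multiFamily_sources_le_payers_cuts`**:
`Σsrc₁ + Σsrc₂ + Σ_i #(B i)_win + Σ_j #(B j)_win ≤ sF·Σ_PAYW(12 − deg) + ΣCUT₁ + ΣCUT₂ + Σ_i CUT_i + Σ_j CUT_j + (#RT₁ + |ι₁|)·rims + (#RT₂ + |ι₂|)·rims′`.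
The instance of record (PRESENTABLE-SUPPLY-g24): `ι₁` = the two one-letter classes `(M_{μ₁} ≫ Fr, −r)` of the basal roots `r` crossing `μ₁` whose continuation
rises, `ι₂` = the two at the top plate; the born family along `−M_{n₁}(Fr r)` is exactly the `[μ₁]`-class CONTINUATION of the plate root `Fr r`, so at coherent
terraces its launches re-credit the plate census's `CUT₁` losses and at incoherent patches they are new supply.
WHAT THIS IS NOT: born SUPPLY (the riser law), the flux/area conversion, any certificate; F-C1 not moved.
-/

noncomputable section

namespace Summit.Ventures.Crystal3D.Theorems

open Summit.Ventures.Crystal3D Finset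
open Literature.MathematicalPhysics.StatisticalMechanics (barlowPos barlowStacking IsHaggSeq barlowPos_mem basalMirror)
open Summit.Ventures.Crystal3D.Cruxes.TextureLiminf.TexShadow (E3 stacking)
open scoped InnerProductSpace

set_option maxHeartbeats 800000 in
open scoped Classical in
/-- **Both plates and finitely many born families under ONE bi-frame row.**  See the module docstring. -/
theorem multiFamily_sources_le_payers_cuts (ver : WordVersion) {δ : ℝ} (hg : KissingGap δ) (hc : KissingClassification δ)
    {σ₁ σ₂ : ℤ → ℤ} (hσ₁ : IsHaggSeq σ₁) (hσ₂ : IsHaggSeq σ₂) (L₁ L₂ : E3 ≃ₗᵢ[ℝ] E3) (s₁ s₂ : E3)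
    (Fr : E3 ≃ₗᵢ[ℝ] E3) {t : ℤ} (hFr : (t = 1 ∧ Fr = L₁) ∨ (t = -1 ∧ Fr = basalMirror.trans L₁))
    (G₂ : E3 ≃ₗᵢ[ℝ] E3) {t' : ℤ} (hG₂ : (t' = 1 ∧ G₂ = L₂) ∨ (t' = -1 ∧ G₂ = basalMirror.trans L₂))
    (hne₁ : (Fr : E3 → E3) '' ↑fccSlots ≠ (L₂ : E3 → E3) '' ↑fccSlots)
    (hne₂ : (Fr : E3 → E3) '' ↑fccSlots ≠ ((basalMirror.trans L₂ : E3 ≃ₗᵢ[ℝ] E3) : E3 → E3) '' ↑fccSlots)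
    (hne₁' : (G₂ : E3 → E3) '' ↑fccSlots ≠ (L₁ : E3 → E3) '' ↑fccSlots)
    (hne₂' : (G₂ : E3 → E3) '' ↑fccSlots ≠ ((basalMirror.trans L₁ : E3 ≃ₗᵢ[ℝ] E3) : E3 → E3) '' ↑fccSlots)
    {sF : ℝ} (hrow : LocalEndRowA ver sF (basalSystem Fr) (basalSystem G₂))
    (X P₁ P₂ : Finset E3) (R₀ h ρ : ℝ) (hR₀ : 5 ≤ R₀) (hρ : R₀ + 2 ≤ ρ)
    (hX : ∀ p ∈ X, ∀ q ∈ X, p ≠ q → 1 ≤ dist p q) (hP₁X : P₁ ⊆ X) (hP₂X : P₂ ⊆ X)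
    (hP₁ : ∀ p, p ∈ P₁ ↔ (p ∈ stacking L₁ s₁ σ₁ ∧ -(2 * R₀) ≤ p 2 ∧ p 2 ≤ -R₀ ∧ p 0 ^ 2 + p 1 ^ 2 ≤ ρ ^ 2))
    (hP₂ : ∀ p, p ∈ P₂ ↔ (p ∈ stacking L₂ s₂ σ₂ ∧ h + R₀ ≤ p 2 ∧ p 2 ≤ h + 2 * R₀ ∧ p 0 ^ 2 + p 1 ^ 2 ≤ ρ ^ 2))
    -- the RISING born families
    {ι₁ : Type*} [Fintype ι₁] (A : ι₁ → (E3 ≃ₗᵢ[ℝ] E3)) (w : ι₁ → E3) (B : ι₁ → Finset E3)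
    (hneA : ∀ i, (A i : E3 → E3) '' ↑fccSlots ≠ (L₂ : E3 → E3) '' ↑fccSlots)
    (hneA' : ∀ i, (A i : E3 → E3) '' ↑fccSlots ≠ ((basalMirror.trans L₂ : E3 ≃ₗᵢ[ℝ] E3) : E3 → E3) '' ↑fccSlots)
    (hw : ∀ i, w i ∈ fccSlots) (hup : ∀ i, 0 < (A i (w i)) 2)
    (hadm₁ : ∀ i, (basalSystem Fr).Adm (A i) (A i (w i)) ∨ (basalSystem G₂).Adm (A i) (A i (w i)))
    (hdir₁ : ∀ i, ∀ r ∈ basalHexagon, A i (w i) ≠ Fr r) (hinj₁ : ∀ i i', A i (w i) = A i' (w i') → i = i')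
    (hborn₁ : ∀ i, ∀ p ∈ B i, p ∈ X ∧ IsFull X (A i) p ∧ p - A i (w i) ∈ X ∧
      ¬ (p - A i (w i) - A i (w i) ∈ X ∧
        (IsFull X (A i) (p - A i (w i)) ∨ (∃ m, IsTwinReading X (A i) m (p - A i (w i)) ∧ ⟪A i (w i), m⟫_ℝ = 0) ∨
          (ver = WordVersion.v2 ∧ IsNarrow X (A i) (A i (w i)) (p - A i (w i))))))
    -- the FALLING born families
    {ι₂ : Type*} [Fintype ι₂] (A' : ι₂ → (E3 ≃ₗᵢ[ℝ] E3)) (w' : ι₂ → E3) (B' : ι₂ → Finset E3)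
    (hneB : ∀ j, (A' j : E3 → E3) '' ↑fccSlots ≠ (L₁ : E3 → E3) '' ↑fccSlots)
    (hneB' : ∀ j, (A' j : E3 → E3) '' ↑fccSlots ≠ ((basalMirror.trans L₁ : E3 ≃ₗᵢ[ℝ] E3) : E3 → E3) '' ↑fccSlots)
    (hw' : ∀ j, w' j ∈ fccSlots) (hdown : ∀ j, (A' j (w' j)) 2 < 0)
    (hadm₂ : ∀ j, (basalSystem Fr).Adm (A' j) (A' j (w' j)) ∨ (basalSystem G₂).Adm (A' j) (A' j (w' j)))
    (hdir₂ : ∀ j, ∀ r ∈ basalHexagon, A' j (w' j) ≠ G₂ r) (hinj₂ : ∀ j j', A' j (w' j) = A' j' (w' j') → j = j')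
    (hborn₂ : ∀ j, ∀ p ∈ B' j, p ∈ X ∧ IsFull X (A' j) p ∧ p - A' j (w' j) ∈ X ∧
      ¬ (p - A' j (w' j) - A' j (w' j) ∈ X ∧
        (IsFull X (A' j) (p - A' j (w' j)) ∨ (∃ m, IsTwinReading X (A' j) m (p - A' j (w' j)) ∧ ⟪A' j (w' j), m⟫_ℝ = 0) ∨
          (ver = WordVersion.v2 ∧ IsNarrow X (A' j) (A' j (w' j)) (p - A' j (w' j)))))) :
    ((∑ r ∈ inPlaneRoots Fr 1,
        ((P₁.filter fun p => -(R₀ + 1) - 1 - 1 ≤ p 2 ∧ p 2 ≤ -(R₀ + 1) - 1 ∧ p 0 ^ 2 + p 1 ^ 2 ≤ (ρ - 1 - 1) ^ 2).filter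
          fun p => (∃ k i j : ℤ, p = L₁ (barlowPos 1 (Real.sqrt (2 / 3)) σ₁ k i j) + s₁ ∧ ¬ (σ₁ (k - 1) = -t ∧ σ₁ k = -t)) ∧
            -(R₀ + 1) - 1 < (p + Fr r) 2 ∧ (p + Fr r) 2 < h + (R₀ + 1) + 1).card : ℕ) : ℝ) +
      ((∑ r ∈ inPlaneRoots G₂ (-1),
        ((P₂.filter fun p => h + (R₀ + 1) + 1 ≤ p 2 ∧ p 2 ≤ h + (R₀ + 1) + 1 + 1 ∧ p 0 ^ 2 + p 1 ^ 2 ≤ (ρ - 1 - 1) ^ 2).filter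
          fun p => (∃ k i j : ℤ, p = L₂ (barlowPos 1 (Real.sqrt (2 / 3)) σ₂ k i j) + s₂ ∧ ¬ (σ₂ (k - 1) = -t' ∧ σ₂ k = -t')) ∧
            -(R₀ + 1) - 1 < (p + G₂ r) 2 ∧ (p + G₂ r) 2 < h + (R₀ + 1) + 1).card : ℕ) : ℝ) +
      ((∑ i, ((B i).filter fun p => -(R₀ + 1) - 1 < (p + A i (w i)) 2 ∧ (p + A i (w i)) 2 < h + (R₀ + 1) + 1).card : ℕ) : ℝ) +
      ((∑ j, ((B' j).filter fun p => -(R₀ + 1) - 1 < (p + A' j (w' j)) 2 ∧ (p + A' j (w' j)) 2 < h + (R₀ + 1) + 1).card : ℕ) : ℝ) ≤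
      sF * ∑ z ∈ X.filter (fun z => (X.filter fun q => dist z q = 1).card ≤ 11 ∧
          -(R₀ + 1) - 2 ≤ z 2 ∧ z 2 ≤ h + (R₀ + 1) + 2), ((12 : ℝ) - ((X.filter fun q => dist z q = 1).card : ℝ)) +
        ((∑ r ∈ inPlaneRoots Fr 1, (X.filter fun b => -(R₀ + 1) - 1 ≤ b 2 ∧ b 2 < h + (R₀ + 1) + 1 ∧
            (∃ μ, ⟪r, μ⟫_ℝ = Real.sqrt (2 / 3) ∧ IsTwinReading X Fr (Fr μ) b) ∧ b - Fr r ∈ X).card : ℕ) : ℝ) +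
        ((∑ r ∈ inPlaneRoots G₂ (-1), (X.filter fun b => -(R₀ + 1) - 1 < b 2 ∧ b 2 ≤ h + (R₀ + 1) + 1 ∧
            (∃ μ, ⟪r, μ⟫_ℝ = Real.sqrt (2 / 3) ∧ IsTwinReading X G₂ (G₂ μ) b) ∧ b - G₂ r ∈ X).card : ℕ) : ℝ) +
        ((∑ i, (X.filter fun b => -(R₀ + 1) - 1 ≤ b 2 ∧ b 2 < h + (R₀ + 1) + 1 ∧
            (∃ μ, ⟪w i, μ⟫_ℝ = Real.sqrt (2 / 3) ∧ IsTwinReading X (A i) (A i μ) b) ∧ b - A i (w i) ∈ X).card : ℕ) : ℝ) +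
        ((∑ j, (X.filter fun b => -(R₀ + 1) - 1 < b 2 ∧ b 2 ≤ h + (R₀ + 1) + 1 ∧
            (∃ μ, ⟪w' j, μ⟫_ℝ = Real.sqrt (2 / 3) ∧ IsTwinReading X (A' j) (A' j μ) b) ∧ b - A' j (w' j) ∈ X).card : ℕ) : ℝ) +
        (((inPlaneRoots Fr 1).card : ℝ) + (Fintype.card ι₁ : ℝ)) *
          (220 * ((X.filter fun s => h + (R₀ + 1) + 1 ≤ s 2 ∧ s 2 ≤ h + (R₀ + 1) + 1 + 1 ∧
              (ρ - 1 - 2) ^ 2 < s 0 ^ 2 + s 1 ^ 2).card : ℝ) +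
            220 * ((X.filter fun s => -(R₀ + 1) - 1 - 1 ≤ s 2 ∧ s 2 < -(R₀ + 1) - 1 ∧
              (ρ - 1 - 1) ^ 2 < s 0 ^ 2 + s 1 ^ 2).card : ℝ)) +
        (((inPlaneRoots G₂ (-1)).card : ℝ) + (Fintype.card ι₂ : ℝ)) *
          (220 * ((X.filter fun s => -(R₀ + 1) - 1 - 1 ≤ s 2 ∧ s 2 ≤ -(R₀ + 1) - 1 ∧
              (ρ - 1 - 2) ^ 2 < s 0 ^ 2 + s 1 ^ 2).card : ℝ) +
            220 * ((X.filter fun s => h + (R₀ + 1) + 1 < s 2 ∧ s 2 ≤ h + (R₀ + 1) + 1 + 1 ∧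
              (ρ - 1 - 1) ^ 2 < s 0 ^ 2 + s 1 ^ 2).card : ℝ)) := by
  set S₁ : PlateSystem := basalSystem Fr with hS₁
  set S₂ : PlateSystem := basalSystem G₂ with hS₂
  -- (1) the two plate families
  obtain ⟨T₁, hkey₁, hT₁pair, hT₁pay, hT₁shape, hT₁wit⟩ := hexagon_barlow_endPairs_cuts_shape ver hg hc hσ₁ hσ₂ L₁ L₂ s₁ s₂ Fr hFr
    hne₁ hne₂ X P₁ P₂ R₀ h ρ hR₀ hρ hX hP₁X hP₂X hP₁ hP₂
  obtain ⟨T₂, hkey₂, hT₂pair, hT₂pay, hT₂shape, hT₂adm⟩ := hexagon_barlow_endPairs_cuts_shape_top ver hg hc hσ₁ hσ₂ L₁ L₂ s₁ s₂ G₂ hG₂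
    hne₁' hne₂' X P₁ P₂ R₀ h ρ hR₀ hρ hX hP₁X hP₂X hP₁ hP₂
  -- (2) the born families, one census each
  have hrise := fun i => born_barlow_endPairs ver hg hc hσ₂ L₁ L₂ s₁ s₂ (A i) (hneA i) (hneA' i) (hw i) (hup i)
    X P₁ P₂ R₀ h ρ hR₀ hρ hX hP₁X hP₂X hP₁ hP₂ (B i) (hborn₁ i)
  have hfall := fun j => born_barlow_endPairs_top ver hg hc hσ₁ L₁ L₂ s₁ s₂ (A' j) (hneB j) (hneB' j) (hw' j) (hdown j)
    X P₁ P₂ R₀ h ρ hR₀ hρ hX hP₁X hP₂X hP₁ hP₂ (B' j) (hborn₂ j)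
  choose U hUkey hUpair hUpay hUmove using hrise
  choose D hDkey hDpair hDpay hDmove using hfall
  -- (3) vertical signs and directions
  have hsgn₁ : ∀ bq ∈ T₁, 0 < (bq.1 - bq.2) 2 := by
    intro bq hbq
    obtain ⟨r', hr', hs, -⟩ := hT₁shape bq hbq
    have hu : 0 < (Fr r') 2 := by have := (mem_filter.1 hr').2.2; linarith
    have e : bq.1 - bq.2 = Fr r' := by rw [hs]; abel
    rw [e]; exact hu
  have hsgn₂ : ∀ bq ∈ T₂, (bq.1 - bq.2) 2 < 0 := by
    intro bq hbq
    obtain ⟨r', hr', hs⟩ := hT₂shape bq hbq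
    have hd : (G₂ r') 2 < 0 := by have := (mem_filter.1 hr').2.2; linarith
    have e : bq.1 - bq.2 = G₂ r' := by rw [hs]; abel
    rw [e]; exact hd
  have hdirU : ∀ i, ∀ bq ∈ U i, bq.1 - bq.2 = A i (w i) := by
    intro i bq hbq
    obtain ⟨-, hs, -⟩ := hUmove i bq hbq
    rw [hs]; abel
  have hdirD : ∀ j, ∀ bq ∈ D j, bq.1 - bq.2 = A' j (w' j) := by
    intro j bq hbq
    obtain ⟨-, hs, -⟩ := hDmove j bq hbq
    rw [hs]; abel
  -- (4) the pooled rising and falling sets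
  set TU : Finset (E3 × E3) := T₁ ∪ Finset.univ.biUnion U with hTU
  set TD : Finset (E3 × E3) := T₂ ∪ Finset.univ.biUnion D with hTD
  have hsgnU : ∀ bq ∈ TU, 0 < (bq.1 - bq.2) 2 := by
    intro bq hbq
    rcases mem_union.1 hbq with h₁ | h₃
    · exact hsgn₁ bq h₁
    · obtain ⟨i, -, hi⟩ := mem_biUnion.1 h₃
      rw [hdirU i bq hi]; exact hup i
  have hsgnD : ∀ bq ∈ TD, (bq.1 - bq.2) 2 < 0 := by
    intro bq hbq
    rcases mem_union.1 hbq with h₂ | h₄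
    · exact hsgn₂ bq h₂
    · obtain ⟨j, -, hj⟩ := mem_biUnion.1 h₄
      rw [hdirD j bq hj]; exact hdown j
  have hdisjUD : Disjoint TU TD := by
    rw [Finset.disjoint_left]
    intro bq h₁ h₂
    have := hsgnU bq h₁; have := hsgnD bq h₂; linarith
  have hU_pair : (Set.univ : Set ι₁).PairwiseDisjoint U := by
    intro i _ i' _ hne
    rw [Function.onFun, Finset.disjoint_left]
    intro bq hi hi'
    exact hne (hinj₁ i i' ((hdirU i bq hi).symm.trans (hdirU i' bq hi')))
  have hD_pair : (Set.univ : Set ι₂).PairwiseDisjoint D := by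
    intro j _ j' _ hne
    rw [Function.onFun, Finset.disjoint_left]
    intro bq hj hj'
    exact hne (hinj₂ j j' ((hdirD j bq hj).symm.trans (hdirD j' bq hj')))
  have hT₁U : Disjoint T₁ (Finset.univ.biUnion U) := by
    rw [Finset.disjoint_left]
    intro bq h₁ h₃
    obtain ⟨i, -, hi⟩ := mem_biUnion.1 h₃
    obtain ⟨r', hr', hs, -⟩ := hT₁shape bq h₁
    have e : bq.1 - bq.2 = Fr r' := by rw [hs]; abel
    exact hdir₁ i r' (inPlaneRoots_subset_basalHexagon Fr 1 hr') ((hdirU i bq hi).symm.trans e)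
  have hT₂D : Disjoint T₂ (Finset.univ.biUnion D) := by
    rw [Finset.disjoint_left]
    intro bq h₂ h₄
    obtain ⟨j, -, hj⟩ := mem_biUnion.1 h₄
    obtain ⟨r', hr', hs⟩ := hT₂shape bq h₂
    have e : bq.1 - bq.2 = G₂ r' := by rw [hs]; abel
    exact hdir₂ j r' (inPlaneRoots_subset_basalHexagon G₂ (-1) hr') ((hdirD j bq hj).symm.trans e)
  have hTUcard : TU.card = T₁.card + ∑ i, (U i).card := by
    rw [hTU, card_union_of_disjoint hT₁U, card_biUnion (fun i _ i' _ hne => hU_pair (Set.mem_univ i) (Set.mem_univ i') hne)]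
  have hTDcard : TD.card = T₂.card + ∑ j, (D j).card := by
    rw [hTD, card_union_of_disjoint hT₂D, card_biUnion (fun j _ j' _ hne => hD_pair (Set.mem_univ j) (Set.mem_univ j') hne)]
  set T := TU ∪ TD with hT
  have hTcard : T.card = T₁.card + ∑ i, (U i).card + (T₂.card + ∑ j, (D j).card) := by
    rw [hT, card_union_of_disjoint hdisjUD, hTUcard, hTDcard]
  -- (5) every pooled pair is an (A)-end pair of (basalSystem Fr, basalSystem G₂)
  have hsub₁ : inPlaneRoots Fr 1 ⊆ basalHexagon := inPlaneRoots_subset_basalHexagon Fr 1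
  have hsub₂ : inPlaneRoots G₂ (-1) ⊆ basalHexagon := inPlaneRoots_subset_basalHexagon G₂ (-1)
  -- `Adm` is monotone in the root set (inline; the tree lemma `PlateSystem.adm_mono` lives in the L12Local-tainted '…RowsOfJoint')
  have adm_mono' : ∀ {G₀ : EuclideanSpace ℝ (Fin 3) ≃ₗᵢ[ℝ] EuclideanSpace ℝ (Fin 3)} {R R' : Finset (EuclideanSpace ℝ (Fin 3))},
      R ⊆ R' → ∀ {G : EuclideanSpace ℝ (Fin 3) ≃ₗᵢ[ℝ] EuclideanSpace ℝ (Fin 3)} {d : EuclideanSpace ℝ (Fin 3)},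
      (⟨G₀, R⟩ : PlateSystem).Adm G d → (⟨G₀, R'⟩ : PlateSystem).Adm G d := by
    intro G₀ R R' h G d hadm
    obtain ⟨r, hr, κ, hκ, hG, hd⟩ := hadm
    have e : (⟨G₀, R⟩ : PlateSystem).Fw κ = (⟨G₀, R'⟩ : PlateSystem).Fw κ :=
      PlateSystem.fw_eq_of_G₀ (S := ⟨G₀, R⟩) (S' := ⟨G₀, R'⟩) rfl κ
    exact ⟨r, h hr, κ, hκ, by rw [hG, e], by rw [hd, e]⟩
  have hEP : ∀ bq ∈ T, IsEndPairA X ver S₁ S₂ bq.1 bq.2 := by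
    intro bq hbq
    rcases mem_union.1 hbq with hU | hD
    · rcases mem_union.1 hU with h₁ | h₃
      · obtain ⟨hb, hq, -, -, -⟩ := hT₁pair bq h₁
        obtain ⟨r, hr, κ, hWF, hpred, hmove⟩ := hT₁wit bq h₁
        have hadm : S₁.Adm ((⟨Fr, inPlaneRoots Fr 1⟩ : PlateSystem).Fw κ)
            ((⟨Fr, inPlaneRoots Fr 1⟩ : PlateSystem).Fw κ (((-1 : ℝ) ^ κ.length) • r)) :=
          adm_mono' hsub₁ ⟨r, hr, κ, hWF, rfl, rfl⟩
        exact ⟨hq, hb, hT₁pay bq h₁, _, _, Or.inl hadm, hpred, hmove⟩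
      · obtain ⟨i, -, hi⟩ := mem_biUnion.1 h₃
        obtain ⟨hb, hq, -, -, -⟩ := hUpair i bq hi
        obtain ⟨-, -, -, hpp, hmove⟩ := hUmove i bq hi
        exact isEndPairA_of_rootMove (hadm₁ i) hq hb (hUpay i bq hi) hpp hmove
    · rcases mem_union.1 hD with h₂ | h₄
      · obtain ⟨hb, hq, -, -, -⟩ := hT₂pair bq h₂
        obtain ⟨G', d', hadm, hpred, hmove⟩ := hT₂adm bq h₂
        exact ⟨hq, hb, hT₂pay bq h₂, G', d', Or.inr (adm_mono' hsub₂ hadm), hpred, hmove⟩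
      · obtain ⟨j, -, hj⟩ := mem_biUnion.1 h₄
        obtain ⟨hb, hq, -, -, -⟩ := hDpair j bq hj
        obtain ⟨-, -, -, hpp, hmove⟩ := hDmove j bq hj
        exact isEndPairA_of_rootMove (hadm₂ j) hq hb (hDpay j bq hj) hpp hmove
  -- (6) ONE application of the local row
  set PAYW := X.filter (fun z => (X.filter fun q => dist z q = 1).card ≤ 11 ∧
    -(R₀ + 1) - 2 ≤ z 2 ∧ z 2 ≤ h + (R₀ + 1) + 2) with hPAYW
  have hwin : ∀ bq ∈ T, -(R₀ + 1) - 1 ≤ bq.1 2 ∧ bq.1 2 ≤ h + (R₀ + 1) + 1 := by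
    intro bq hbq
    rcases mem_union.1 hbq with hU | hD
    · rcases mem_union.1 hU with h₁ | h₃
      · obtain ⟨-, -, -, h4, h5⟩ := hT₁pair bq h₁; exact ⟨h4, h5.le⟩
      · obtain ⟨i, -, hi⟩ := mem_biUnion.1 h₃
        obtain ⟨-, -, -, h4, h5⟩ := hUpair i bq hi; exact ⟨h4, h5.le⟩
    · rcases mem_union.1 hD with h₂ | h₄
      · obtain ⟨-, -, -, h4, h5⟩ := hT₂pair bq h₂; exact ⟨h4.le, h5⟩
      · obtain ⟨j, -, hj⟩ := mem_biUnion.1 h₄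
        obtain ⟨-, -, -, h4, h5⟩ := hDpair j bq hj; exact ⟨h4.le, h5⟩
  have hclosed : ∀ bq ∈ T, ∀ z ∈ X, dist bq.1 z ≤ 1 → (X.filter fun q => dist z q = 1).card ≤ 11 → z ∈ PAYW := by
    intro bq hbq z hzX hdz hz11
    obtain ⟨h4, h5⟩ := hwin bq hbq
    have h2 : (z 2 - bq.1 2) ^ 2 ≤ 1 := by
      have := sq_sub_apply_le_dist_sq z bq.1 2
      rw [dist_comm] at hdz; nlinarith [this, hdz, dist_nonneg (x := z) (y := bq.1)]
    have h2' : |z 2 - bq.1 2| ≤ 1 := by rw [← sq_le_one_iff_abs_le_one]; exact h2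
    obtain ⟨ha, hb⟩ := abs_le.1 h2'
    exact mem_filter.2 ⟨hzX, hz11, by linarith, by linarith⟩
  have key := card_endPairs_le_of_localRowA hX ver S₁ S₂ T PAYW hEP
    (fun z hz => ⟨(mem_filter.1 hz).1, (mem_filter.1 hz).2.1⟩) hclosed hrow
  -- (7) assemble: sum the born censuses over the index types
  have hUsum : ((∑ i, ((B i).filter fun p => -(R₀ + 1) - 1 < (p + A i (w i)) 2 ∧ (p + A i (w i)) 2 < h + (R₀ + 1) + 1).card : ℕ) : ℝ) ≤
      ((∑ i, (U i).card : ℕ) : ℝ) +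
        ((∑ i, (X.filter fun b => -(R₀ + 1) - 1 ≤ b 2 ∧ b 2 < h + (R₀ + 1) + 1 ∧
            (∃ μ, ⟪w i, μ⟫_ℝ = Real.sqrt (2 / 3) ∧ IsTwinReading X (A i) (A i μ) b) ∧ b - A i (w i) ∈ X).card : ℕ) : ℝ) +
        (Fintype.card ι₁ : ℝ) *
          (220 * ((X.filter fun s => h + (R₀ + 1) + 1 ≤ s 2 ∧ s 2 ≤ h + (R₀ + 1) + 1 + 1 ∧
              (ρ - 1 - 2) ^ 2 < s 0 ^ 2 + s 1 ^ 2).card : ℝ) +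
            220 * ((X.filter fun s => -(R₀ + 1) - 1 - 1 ≤ s 2 ∧ s 2 < -(R₀ + 1) - 1 ∧
              (ρ - 1 - 1) ^ 2 < s 0 ^ 2 + s 1 ^ 2).card : ℝ)) := by
    have hsum := Finset.sum_le_sum fun i (_ : i ∈ (Finset.univ : Finset ι₁)) => hUkey i
    rw [Finset.sum_add_distrib, Finset.sum_add_distrib, Finset.sum_add_distrib, Finset.sum_const, Finset.card_univ,
      smul_eq_mul, Finset.sum_const, Finset.card_univ, smul_eq_mul] at hsum
    have hcast := (Nat.cast_le (α := ℝ)).2 hsum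
    push_cast at hcast ⊢
    linarith only [hcast]
  have hDsum : ((∑ j, ((B' j).filter fun p => -(R₀ + 1) - 1 < (p + A' j (w' j)) 2 ∧ (p + A' j (w' j)) 2 < h + (R₀ + 1) + 1).card : ℕ) : ℝ) ≤
      ((∑ j, (D j).card : ℕ) : ℝ) +
        ((∑ j, (X.filter fun b => -(R₀ + 1) - 1 < b 2 ∧ b 2 ≤ h + (R₀ + 1) + 1 ∧
            (∃ μ, ⟪w' j, μ⟫_ℝ = Real.sqrt (2 / 3) ∧ IsTwinReading X (A' j) (A' j μ) b) ∧ b - A' j (w' j) ∈ X).card : ℕ) : ℝ) +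
        (Fintype.card ι₂ : ℝ) *
          (220 * ((X.filter fun s => -(R₀ + 1) - 1 - 1 ≤ s 2 ∧ s 2 ≤ -(R₀ + 1) - 1 ∧
              (ρ - 1 - 2) ^ 2 < s 0 ^ 2 + s 1 ^ 2).card : ℝ) +
            220 * ((X.filter fun s => h + (R₀ + 1) + 1 < s 2 ∧ s 2 ≤ h + (R₀ + 1) + 1 + 1 ∧
              (ρ - 1 - 1) ^ 2 < s 0 ^ 2 + s 1 ^ 2).card : ℝ)) := by
    have hsum := Finset.sum_le_sum fun j (_ : j ∈ (Finset.univ : Finset ι₂)) => hDkey j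
    rw [Finset.sum_add_distrib, Finset.sum_add_distrib, Finset.sum_add_distrib, Finset.sum_const, Finset.card_univ,
      smul_eq_mul, Finset.sum_const, Finset.card_univ, smul_eq_mul] at hsum
    have hcast := (Nat.cast_le (α := ℝ)).2 hsum
    push_cast at hcast ⊢
    linarith only [hcast]
  rw [hTcard] at key
  push_cast at key
  have hk₁ := (Nat.cast_le (α := ℝ)).2 hkey₁
  have hk₂ := (Nat.cast_le (α := ℝ)).2 hkey₂
  push_cast at hk₁ hk₂ hUsum hDsum ⊢
  linarith only [hk₁, hk₂, hUsum, hDsum, key]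

end Summit.Ventures.Crystal3D.Theorems

end
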